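import Summits.ValiantsHypothesis.ValiantsHypothesis.Theorems.RigidityForcesSymmetryRankRigidMinimalReprLaplaceDefs

/-!
# Padding: the hypothesis «some term carries depth-one cut-junk» is free (cost `24`) — so
# `stub_depthOneUncancellable_five ⟹ LaplaceOptimal 5 for every weight < 96`
# (Negative lane of stmt-ValiantsHypothesis-24813; joint-sufficiency audit of LINE `shallow_collision` rev 3, stub S3; val-neg-2 g2)

S3 of `Cruxes/LaplaceOptimalFive/Lines/shallow_collision.lean` (`stub_depthOneUncancellable_five`, g3 K2 verbatim) reads: an exact
cylindrical term system for `P₅` in which SOME term `t ∈ T` has `u_t v · w_t v ≠ 0` at SOME depth-one cut word `v` (four letters,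
injective on `S_t` and on `S_tᶜ`) has Laplace weight `≥ 5!`.  `pad_*` below show that this hypothesis can be MANUFACTURED from any
exact cylindrical system at Laplace cost `24`: append two terms on the split `{0,1}` with constant factors `(+1)·1` and `(−1)·1`.
They cancel identically (exactness and cylindricity are kept), and the first of them is non-zero at the depth-one cut word
`v = (0,1,0,2,3)`.  Hence (`below96_of_depthOneUncancellable`) S3 implies that EVERY exact cylindrical system has weight `≥ 96`
— i.e. S3 contains `LaplaceOptimal 5` on the whole range `[72, 96)` (the tree's unconditional bound is `≥ 72`, p633018) with no
use of depth-one structure; conversely `LaplaceOptimal 5 ⟹ S3` trivially (`depthOneUncancellable_of_laplaceOptimal_five`).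
Reading for the line: S3's hypothesis is inert as typed («depth-one junk cannot be cancelled below 120» is not what it says —
the twin term cancels it for free); a repaired S3 must be quantitative (weight accounted per junk-carrying / junk-cleaning term)
or stated under a normal form that merges proportional short factors on one split.  Nothing here refutes S3 (it is TRUE if the
crux is) or touches S1/S2; `LaplaceOptimalFive` (24813) stays OPEN; VP ≠ VNP is NOT proved.
-/

set_option autoImplicit false

-- the mandated summit-side namespace repeats a component by design (single-problem summit)
set_option linter.dupNamespace false

open Finset
open Summit.ValiantsHypothesis.ValiantsHypothesis.Theorems.RigidityForcesSymmetryRankRigidMinimalRepr (LaplaceOptimal)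

namespace Summit.ValiantsHypothesis.ValiantsHypothesis.Theorems.LaplaceOptimalFiveNegative.DepthOnePadding

/-- The two padding indices are distinct. -/
theorem natAdd_zero_ne_one (N : ℕ) : (Fin.natAdd N (0 : Fin 2)) ≠ Fin.natAdd N 1 := by
  intro h
  have := congrArg Fin.val h
  simp at this

/-- The old terms (embedded by `Fin.castAddEmb 2`) are disjoint from the two padding indices. -/
theorem disjoint_pad {N : ℕ} (T : Finset (Fin N)) :
    Disjoint (T.map (Fin.castAddEmb 2)) ({Fin.natAdd N (0 : Fin 2), Fin.natAdd N 1} : Finset (Fin (N + 2))) := by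
  rw [Finset.disjoint_left]
  intro x hx hx'
  simp only [Finset.mem_map, Finset.mem_insert, Finset.mem_singleton] at hx hx'
  obtain ⟨i, -, rfl⟩ := hx
  have hi := i.isLt
  rcases hx' with h | h
  · have := congrArg Fin.val h
    simp at this
    omega
  · have := congrArg Fin.val h
    simp at this
    omega

/-- Sums over the padded index set split as «old terms + the two new ones». -/
theorem sum_pad {N : ℕ} {M : Type*} [AddCommMonoid M] (T : Finset (Fin N)) (f : Fin (N + 2) → M) :
    (∑ t ∈ T.map (Fin.castAddEmb 2) ∪ {Fin.natAdd N (0 : Fin 2), Fin.natAdd N 1}, f t)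
      = (∑ t ∈ T, f (Fin.castAdd 2 t)) + (f (Fin.natAdd N 0) + f (Fin.natAdd N 1)) := by
  rw [Finset.sum_union (disjoint_pad T), Finset.sum_map, Finset.sum_pair (natAdd_zero_ne_one N)]
  simp [Fin.castAddEmb_apply]

set_option maxHeartbeats 800000 in
/-- **`S3 ⟹ LaplaceOptimal 5 below 96`.**  If `stub_depthOneUncancellable_five` (stated verbatim as the hypothesis `S3`) holds,
then every cylindrical term system reproducing `P₅` exactly has Laplace weight `≥ 96` — by padding with the cancelling constant
pair on the split `{0,1}`, which supplies S3's depth-one witness at cost `24`. -/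
theorem below96_of_depthOneUncancellable
    (S3 : ∀ (N : ℕ) (T : Finset (Fin N)) (S : Fin N → Finset (Fin 5)) (u w : Fin N → (Fin 5 → Fin 5) → ℂ),
      (∀ t, ∀ v v' : Fin 5 → Fin 5, (∀ i ∈ S t, v i = v' i) → u t v = u t v') →
      (∀ t, ∀ v v' : Fin 5 → Fin 5, (∀ i, i ∉ S t → v i = v' i) → w t v = w t v') →
      (∀ v : Fin 5 → Fin 5, (∑ t ∈ T, u t v * w t v) = if Function.Injective v then 1 else 0) →
      (∃ t ∈ T, ∃ v : Fin 5 → Fin 5, (Finset.univ.image v).card = 4 ∧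
        Set.InjOn v (↑(S t) : Set (Fin 5)) ∧ Set.InjOn v ((↑(S t) : Set (Fin 5))ᶜ) ∧ u t v * w t v ≠ 0) →
      Nat.factorial 5 ≤ ∑ t ∈ T, (S t).card.factorial * (5 - (S t).card).factorial) :
    ∀ (N : ℕ) (T : Finset (Fin N)) (S : Fin N → Finset (Fin 5)) (u w : Fin N → (Fin 5 → Fin 5) → ℂ),
      (∀ t, ∀ v v' : Fin 5 → Fin 5, (∀ i ∈ S t, v i = v' i) → u t v = u t v') →
      (∀ t, ∀ v v' : Fin 5 → Fin 5, (∀ i, i ∉ S t → v i = v' i) → w t v = w t v') →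
      (∀ v : Fin 5 → Fin 5, (∑ t ∈ T, u t v * w t v) = if Function.Injective v then 1 else 0) →
      96 ≤ ∑ t ∈ T, (S t).card.factorial * (5 - (S t).card).factorial := by
  intro N T S u w hu hw hid
  -- the padded system
  let T' : Finset (Fin (N + 2)) := T.map (Fin.castAddEmb 2) ∪ {Fin.natAdd N (0 : Fin 2), Fin.natAdd N 1}
  let S' : Fin (N + 2) → Finset (Fin 5) := Fin.append S ![{0, 1}, {0, 1}]
  let u' : Fin (N + 2) → (Fin 5 → Fin 5) → ℂ := Fin.append u ![fun _ => 1, fun _ => -1]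
  let w' : Fin (N + 2) → (Fin 5 → Fin 5) → ℂ := Fin.append w ![fun _ => 1, fun _ => 1]
  have hS0 : S' (Fin.natAdd N 0) = {0, 1} := by simp [S']
  have hS1 : S' (Fin.natAdd N 1) = {0, 1} := by simp [S']
  have hu0 : ∀ v, u' (Fin.natAdd N 0) v = 1 := fun v => by simp [u']
  have hu1 : ∀ v, u' (Fin.natAdd N 1) v = -1 := fun v => by simp [u']
  have hw0 : ∀ v, w' (Fin.natAdd N 0) v = 1 := fun v => by simp [w']
  have hw1 : ∀ v, w' (Fin.natAdd N 1) v = 1 := fun v => by simp [w']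
  have hSl : ∀ i : Fin N, S' (Fin.castAdd 2 i) = S i := fun i => by simp [S']
  have hul : ∀ i : Fin N, ∀ v, u' (Fin.castAdd 2 i) v = u i v := fun i v => by simp [u']
  have hwl : ∀ i : Fin N, ∀ v, w' (Fin.castAdd 2 i) v = w i v := fun i v => by simp [w']
  -- cylindricity of the padded system
  have hu' : ∀ t, ∀ v v' : Fin 5 → Fin 5, (∀ i ∈ S' t, v i = v' i) → u' t v = u' t v' := by
    intro t v v' h
    cases t using Fin.addCases with
    | left i => rw [hul, hul]; exact hu i v v' (fun j hj => h j (by rw [hSl]; exact hj))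
    | right j =>
      fin_cases j
      · exact (hu0 v).trans (hu0 v').symm
      · exact (hu1 v).trans (hu1 v').symm
  have hw' : ∀ t, ∀ v v' : Fin 5 → Fin 5, (∀ i, i ∉ S' t → v i = v' i) → w' t v = w' t v' := by
    intro t v v' h
    cases t using Fin.addCases with
    | left i => rw [hwl, hwl]; exact hw i v v' (fun j hj => h j (by rw [hSl]; exact hj))
    | right j =>
      fin_cases j
      · exact (hw0 v).trans (hw0 v').symm
      · exact (hw1 v).trans (hw1 v').symm
  -- exactness is kept: the two new terms cancel
  have hid' : ∀ v : Fin 5 → Fin 5, (∑ t ∈ T', u' t v * w' t v) = if Function.Injective v then 1 else 0 := by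
    intro v
    rw [sum_pad, ← hid v]
    simp only [hul, hwl, hu0, hu1, hw0, hw1]
    ring
  -- the depth-one witness is free: term `natAdd N 0` at `v = (0,1,0,2,3)`
  have hex : ∃ t ∈ T', ∃ v : Fin 5 → Fin 5, (Finset.univ.image v).card = 4 ∧
      Set.InjOn v (↑(S' t) : Set (Fin 5)) ∧ Set.InjOn v ((↑(S' t) : Set (Fin 5))ᶜ) ∧ u' t v * w' t v ≠ 0 := by
    refine ⟨Fin.natAdd N 0, ?_, ![0, 1, 0, 2, 3], by decide, ?_, ?_, ?_⟩
    · simp [T']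
    · rw [hS0]
      intro a ha b hb hab
      simp only [Finset.coe_insert, Finset.coe_singleton, Set.mem_insert_iff, Set.mem_singleton_iff] at ha hb
      rcases ha with rfl | rfl <;> rcases hb with rfl | rfl <;> first | rfl | exact absurd hab (by decide)
    · rw [hS0]
      intro a ha b hb hab
      simp only [Finset.coe_insert, Finset.coe_singleton, Set.mem_compl_iff, Set.mem_insert_iff,
        Set.mem_singleton_iff, not_or] at ha hb
      fin_cases a <;> fin_cases b <;> first | rfl | exact absurd hab (by decide) | exact (ha.1 rfl).elim | exact (ha.2 rfl).elim | exact (hb.1 rfl).elim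
    · rw [hu0, hw0]; norm_num
  -- apply S3 to the padded system and read off the weight
  have key := S3 (N + 2) T' S' u' w' hu' hw' hid' hex
  have hwt : (∑ t ∈ T', (S' t).card.factorial * (5 - (S' t).card).factorial)
      = (∑ t ∈ T, (S t).card.factorial * (5 - (S t).card).factorial) + 24 := by
    rw [sum_pad]
    simp only [hSl, hS0, hS1]
    have h12 : (({0, 1} : Finset (Fin 5)).card.factorial * (5 - ({0, 1} : Finset (Fin 5)).card).factorial) = 12 := by
      decide
    rw [h12]
  rw [hwt] at key
  have h120 : Nat.factorial 5 = 120 := by decide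
  omega

/-- Conversely (trivial direction of the sandwich): `LaplaceOptimal 5` implies S3 — the extra hypothesis is simply dropped. -/
theorem depthOneUncancellable_of_laplaceOptimal_five (h : LaplaceOptimal 5) :
    ∀ (N : ℕ) (T : Finset (Fin N)) (S : Fin N → Finset (Fin 5)) (u w : Fin N → (Fin 5 → Fin 5) → ℂ),
      (∀ t, ∀ v v' : Fin 5 → Fin 5, (∀ i ∈ S t, v i = v' i) → u t v = u t v') →
      (∀ t, ∀ v v' : Fin 5 → Fin 5, (∀ i, i ∉ S t → v i = v' i) → w t v = w t v') →
      (∀ v : Fin 5 → Fin 5, (∑ t ∈ T, u t v * w t v) = if Function.Injective v then 1 else 0) →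
      (∃ t ∈ T, ∃ v : Fin 5 → Fin 5, (Finset.univ.image v).card = 4 ∧
        Set.InjOn v (↑(S t) : Set (Fin 5)) ∧ Set.InjOn v ((↑(S t) : Set (Fin 5))ᶜ) ∧ u t v * w t v ≠ 0) →
      Nat.factorial 5 ≤ ∑ t ∈ T, (S t).card.factorial * (5 - (S t).card).factorial :=
  fun N T S u w hu hw hid _ => h N T S u w hu hw hid

end Summit.ValiantsHypothesis.ValiantsHypothesis.Theorems.LaplaceOptimalFiveNegative.DepthOnePadding
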